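import Mathlib

/-!
# Finiteness of `κ[[X₀,X₁,X₂]] ⧸ J` when `J` contains a power of each variable
(negative-side support for crux stmt-ResolutionOfSingularities-16882, refuter crux-disprover seat; this file
does NOT refute the crux)

The `Isol c` predicate of the `WildCones` crux calculus is `Module.Finite κ (κ[[u]] ⧸ (∂a))` — the
Jacobian ideal of the cleaned state is `m`-primary. `moduleFinite_quotient_of_X_pow_mem` is the
reusable CERTIFICATE for it: exhibit a power of each variable in the ideal. Proof: every series is,
modulo `(X₀^(a+1), X₁^(b+1), X₂^(c+1))`, its box truncation `MvPowerSeries.trunc'`, a finite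
`κ`-combination of box monomials. Used by `Negative/FuelFamilyNarrow.lean` (isolated narrow runs of
every finite length) and available to every seat that must certify `Isol` on explicit states
(`ConeExit` witnesses, `ClassicalRegimes`, `BoundedMilnor`).
-/

noncomputable section

set_option linter.dupNamespace false

namespace Summit.ResolutionOfSingularities.ResolutionOfSingularities.Theorems.NarrowRunsDie.Negative

open MvPowerSeries


variable {κ : Type} [Field κ]

/-- Coefficients of `X s ^ d * φ` in three variables. -/
theorem coeff_X_pow_mul (s : Fin 3) (d : ℕ) (φ : MvPowerSeries (Fin 3) κ) (e : Fin 3 →₀ ℕ) :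
    MvPowerSeries.coeff e (MvPowerSeries.X s ^ d * φ) =
      if d ≤ e s then MvPowerSeries.coeff (e - Finsupp.single s d) φ else 0 := by
  rw [MvPowerSeries.X_pow_eq, MvPowerSeries.coeff_monomial_mul, one_mul]
  by_cases h : d ≤ e s
  · rw [if_pos (Finsupp.single_le_iff.mpr h), if_pos h]
  · rw [if_neg (fun hle => h (Finsupp.single_le_iff.mp hle)), if_neg h]

/-- **Finiteness of a Jacobian-type quotient.** If an ideal `J` of `κ[[X₀,X₁,X₂]]` contains a
power of each variable, `κ[[X]] ⧸ J` is a finite `κ`-module: every series is, modulo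
`(X₀^(a+1), X₁^(b+1), X₂^(c+1)) ⊆ J`, its box truncation `trunc'`, a `κ`-combination of the
finitely many box monomials. (Reusable `Isol` certificate: `Isol c` of the route calculus is
`Module.Finite κ (κ[[u]] ⧸ (∂a))`.) -/
theorem moduleFinite_quotient_of_X_pow_mem (J : Ideal (MvPowerSeries (Fin 3) κ)) (a b c : ℕ)
    (h0 : MvPowerSeries.X 0 ^ (a + 1) ∈ J) (h1 : MvPowerSeries.X 1 ^ (b + 1) ∈ J)
    (h2 : MvPowerSeries.X 2 ^ (c + 1) ∈ J) :
    Module.Finite κ (MvPowerSeries (Fin 3) κ ⧸ J) := by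
  classical
  set nB : Fin 3 →₀ ℕ := Finsupp.single 0 a + Finsupp.single 1 b + Finsupp.single 2 c with hnB
  have hnB0 : nB 0 = a := by simp [hnB]
  have hnB1 : nB 1 = b := by simp [hnB]
  have hnB2 : nB 2 = c := by simp [hnB]
  have hle : ∀ e : Fin 3 →₀ ℕ, e ≤ nB ↔ e 0 ≤ a ∧ e 1 ≤ b ∧ e 2 ≤ c := by
    intro e
    rw [Finsupp.le_def]
    constructor
    · intro h; exact ⟨hnB0 ▸ h 0, hnB1 ▸ h 1, hnB2 ▸ h 2⟩
    · rintro ⟨h0', h1', h2'⟩ i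
      fin_cases i
      · simpa [hnB0] using h0'
      · simpa [hnB1] using h1'
      · simpa [hnB2] using h2'
  have hdec : ∀ f : MvPowerSeries (Fin 3) κ,
      f - ((MvPowerSeries.trunc' κ nB f : MvPolynomial (Fin 3) κ) : MvPowerSeries (Fin 3) κ) ∈ J := by
    intro f
    let g0 : MvPowerSeries (Fin 3) κ := fun A => MvPowerSeries.coeff (A + Finsupp.single 0 (a + 1)) f
    let g1 : MvPowerSeries (Fin 3) κ := fun A =>
      if A 0 ≤ a then MvPowerSeries.coeff (A + Finsupp.single 1 (b + 1)) f else 0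
    let g2 : MvPowerSeries (Fin 3) κ := fun A =>
      if A 0 ≤ a ∧ A 1 ≤ b then MvPowerSeries.coeff (A + Finsupp.single 2 (c + 1)) f else 0
    have key : f - ((MvPowerSeries.trunc' κ nB f : MvPolynomial (Fin 3) κ) : MvPowerSeries (Fin 3) κ) =
        MvPowerSeries.X 0 ^ (a + 1) * g0 + MvPowerSeries.X 1 ^ (b + 1) * g1 +
          MvPowerSeries.X 2 ^ (c + 1) * g2 := by
      ext e
      simp only [map_sub, map_add, MvPolynomial.coeff_coe, MvPowerSeries.coeff_trunc',
        coeff_X_pow_mul]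
      have e0 : ∀ A, MvPowerSeries.coeff A g0 = MvPowerSeries.coeff (A + Finsupp.single 0 (a + 1)) f :=
        fun A => rfl
      have e1 : ∀ A, MvPowerSeries.coeff A g1 =
          if A 0 ≤ a then MvPowerSeries.coeff (A + Finsupp.single 1 (b + 1)) f else 0 := fun A => rfl
      have e2 : ∀ A, MvPowerSeries.coeff A g2 =
          if A 0 ≤ a ∧ A 1 ≤ b then MvPowerSeries.coeff (A + Finsupp.single 2 (c + 1)) f else 0 :=
        fun A => rfl
      simp only [e0, e1, e2, Finsupp.tsub_apply, Finsupp.single_apply]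
      simp only [Fin.isValue, ↓reduceIte, tsub_zero, show ((2 : Fin 3) = 0) = False from by decide,
        show ((2 : Fin 3) = 1) = False from by decide, show ((1 : Fin 3) = 0) = False from by decide]
      by_cases ha : a + 1 ≤ e 0
      · have hbox : ¬ e ≤ nB := fun h => by have := ((hle e).1 h).1; omega
        rw [if_pos ha, if_neg hbox, tsub_add_cancel_of_le (Finsupp.single_le_iff.mpr ha)]
        have : ¬ e 0 ≤ a := by omega
        simp [this]
      · rw [if_neg ha]
        have ha' : e 0 ≤ a := by omega
        by_cases hb : b + 1 ≤ e 1
        · have hbox : ¬ e ≤ nB := fun h => by have := ((hle e).1 h).2.1; omega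
          rw [if_pos hb, if_neg hbox, if_pos ha', tsub_add_cancel_of_le (Finsupp.single_le_iff.mpr hb)]
          have : ¬ e 1 ≤ b := by omega
          simp [this]
        · rw [if_neg hb]
          have hb' : e 1 ≤ b := by omega
          by_cases hc : c + 1 ≤ e 2
          · have hbox : ¬ e ≤ nB := fun h => by have := ((hle e).1 h).2.2; omega
            rw [if_pos hc, if_neg hbox, if_pos ⟨ha', hb'⟩,
              tsub_add_cancel_of_le (Finsupp.single_le_iff.mpr hc)]
            simp
          · have hbox : e ≤ nB := (hle e).2 ⟨ha', hb', by omega⟩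
            rw [if_neg hc, if_pos hbox]
            simp
    rw [key]
    exact J.add_mem (J.add_mem (J.mul_mem_right _ h0) (J.mul_mem_right _ h1)) (J.mul_mem_right _ h2)
  refine Module.finite_def.mpr ⟨(Finset.Iic nB).image
    (fun v => Ideal.Quotient.mk J (MvPowerSeries.monomial v (1 : κ))), ?_⟩
  rw [eq_top_iff]
  rintro x -
  obtain ⟨f, rfl⟩ := Ideal.Quotient.mk_surjective x
  have hq : Ideal.Quotient.mk J f =
      Ideal.Quotient.mk J ((MvPowerSeries.trunc' κ nB f : MvPolynomial (Fin 3) κ) : MvPowerSeries (Fin 3) κ) :=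
    (Ideal.Quotient.eq).2 (hdec f)
  rw [hq, MvPolynomial.as_sum (MvPowerSeries.trunc' κ nB f)]
  rw [show ((∑ v ∈ (MvPowerSeries.trunc' κ nB f).support,
      MvPolynomial.monomial v (MvPolynomial.coeff v (MvPowerSeries.trunc' κ nB f)) :
        MvPolynomial (Fin 3) κ) : MvPowerSeries (Fin 3) κ) =
      ∑ v ∈ (MvPowerSeries.trunc' κ nB f).support,
        ((MvPolynomial.monomial v (MvPolynomial.coeff v (MvPowerSeries.trunc' κ nB f)) :
          MvPolynomial (Fin 3) κ) : MvPowerSeries (Fin 3) κ) from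
    map_sum (MvPolynomial.coeToMvPowerSeries.ringHom : MvPolynomial (Fin 3) κ →+* _) _ _]
  rw [map_sum]
  refine Submodule.sum_mem _ fun v hv => ?_
  have hvle : v ≤ nB := by
    have := MvPolynomial.mem_support_iff.mp hv
    rw [MvPowerSeries.coeff_trunc'] at this
    by_contra hcon
    exact this (if_neg hcon)
  rw [MvPolynomial.coe_monomial,
    show MvPowerSeries.monomial v (MvPolynomial.coeff v (MvPowerSeries.trunc' κ nB f)) =
      MvPolynomial.coeff v (MvPowerSeries.trunc' κ nB f) • MvPowerSeries.monomial v (1 : κ) from by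
        rw [← (MvPowerSeries.monomial v).map_smul, smul_eq_mul, mul_one],
    ← Ideal.Quotient.mkₐ_eq_mk κ, map_smul]
  refine Submodule.smul_mem _ _ (Submodule.subset_span ?_)
  rw [Finset.coe_image]
  exact ⟨v, by simpa using hvle, by rw [Ideal.Quotient.mkₐ_eq_mk]⟩


end Summit.ResolutionOfSingularities.ResolutionOfSingularities.Theorems.NarrowRunsDie.Negative

end
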